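import Summits.CriticalPhenomena.CardyFormulaZ2.Theorems.CardyMagicRigidityNestingRigidityNeckFourArmInputsT
import Literature.Probability.Percolation.ArmEventsAPriori
import Literature.Probability.Percolation.BKFinitary
import Literature.Probability.Percolation.SiteBK
import Literature.Probability.Percolation.SiteConnectionTools
import HarnessLib

/-!
# Crux `NestingRigidity`, line `pinch-resampling` (v4), stub S11: one open arm of `𝕋` at a centre — big blobs touch sparsely, distinct clusters cost the product

Crux `Summit.CriticalPhenomena.CardyFormulaZ2.Theses.CardyMagicRigidity.NestingRigidity` (stmt-CriticalPhenomena-4835),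
line `pinch-resampling` v4, stub S11 `stub_neckHookupCoarseT : NeckHookupCoarseT`.  The site-`𝕋` twins of
`…NeckZ2TouchDensity` and `…NeckZ2NodeBK` (stub S12): the second and third probabilistic primitives of the summation of
the node events of the S11 road map (with `…NeckNodeProductT`, `…NeckNodeCountingT`) — the locales of virtual edges are
inner-layer sites of BIG blobs (`𝕋`-diameter `≥ lam`), DENSE clumps of locales are controlled by the sparseness of such
touch points, and arms of pairwise DISTINCT open clusters cost the product of the one-arm bounds (van den Berg–Kesten).
Entirely from tree theorems (the a priori one-arm bound `exists_polyArmProb_one_le_rpow`, translation invariance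
`sitePercolation_real_preimage_relabel`, independence of events determined by disjoint site sets
`measureReal_inter_of_determinedBy_compl`, the BK inequality for site percolation `sitePercolation_bk` and the witness
criterion `mem_disjointOccurrenceList_of_pairwise_disjoint`).  The one-arm event at centre `w` is written as the set
`{ω | ∃ p q, |p - w| = r ∧ |q - w| = R ∧ p ⇝ q open inside {r ≤ |· - w| ≤ R}}` (no new definition):

* §1 `NeckCoarse.tOneArm_of_bigBlob` — a collar blob of `𝕋`-diameter `≥ lam` through a site `c` with `|c - w|_𝕋 ≤ r`
  crosses `{r+1 ≤ |· - w| ≤ R}` whenever `r + 1 < R`, `2 (R + r) ≤ lam` (crossing extraction `PathIn.exists_annulus_arm`).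
* §2 `NeckCoarse.real_tOneArm_le` — `P_{1/2}(one open arm) ≤ C (r/R)^α` (shift to the origin, where the event is the
  tree's `armEvent ![true] r R`); locality, measurability and independence over disjoint annuli
  (`NeckCoarse.real_biInter_tOneArm_eq_prod`).
* §3 `real_forall_bigBlobT_near_le_pow` (registered anchor): for annuli `{r+1 ≤ |· - w i| ≤ R}` pairwise disjoint and
  `2 (R + r) ≤ lam`, the probability that EVERY `w i` has a big collar blob through a site within `r` of it is at most
  `(C ((r+1)/R)^α)^{#t}` — geometric decay in the number of windows of a dense touching run.
* §4 `NeckCoarse.sitePercolation_bk_list` — iterated BK for a list of increasing events determined by one finite set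
  of sites; `NeckCoarse.mem_disjointOccurrenceList_of_distinctClusters` — distinct clusters give site-disjoint open
  witnesses (tight supports of the extracted crossings).
* §5 `real_distinctClustersT_arms_le_prod` (registered anchor): if pairwise distinct open clusters join `c i`
  (`|c i - w i|_𝕋 < r i`) to `𝕋`-distance `≥ R i` from `w i`, the probability is at most `∏ C (r i / R i)^α`, with NO
  disjointness hypothesis on the annuli.
-/

noncomputable section

namespace Summit.CriticalPhenomena.CardyFormulaZ2.Cruxes.NestingRigidity.PinchResampling

open MeasureTheory Set Literature.Probability.Percolation Literature.Probability.LatticeModels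

namespace NeckCoarse

variable {ω : SiteConfig (Site 2)}

/-! ## §1 One open arm across a hexagonal annulus, and big blobs -/

/-- **A big blob near `w` crosses the annulus around `w`**: if the collar blob of a site `c` with `|c - w|_𝕋 ≤ r` has two
sites at `𝕋`-distance `≥ lam`, then `{r+1 ≤ |· - w| ≤ R}` is crossed by an open path for every `R` with `r + 1 ≤ R` and
`2 (R + r) ≤ lam`, `r + 1 < R` (one of the two sites is at distance `≥ R` from `w`; cut the open path from `c` to it down
to the annulus). -/
theorem tOneArm_of_bigBlob {x c w : Site 2} {s lam r R : ℕ} (hcw : triNorm (c - w) ≤ r) (hrR : r + 1 < R)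
    (hlam : 2 * (R + r) ≤ lam)
    (hbig : ∃ u ∈ blobOf (tColourGraph ω true) (tBall x (2 * s) \ tBall x s) c,
      ∃ u' ∈ blobOf (tColourGraph ω true) (tBall x (2 * s) \ tBall x s) c, (lam : ℤ) ≤ triNorm (u - u')) :
    ω ∈ {ω : SiteConfig (Site 2) | ∃ p q : Site 2, triNorm (p - w) = (r + 1 : ℕ) ∧ triNorm (q - w) = R ∧
      PathIn (tColourGraph ω true) {y | ((r + 1 : ℕ) : ℤ) ≤ triNorm (y - w) ∧ triNorm (y - w) ≤ R} p q} := by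
  obtain ⟨u, hu, u', hu', hd⟩ := hbig
  -- one of `u`, `u'` is at distance `≥ R` from `w`
  have hfar : ∃ v ∈ blobOf (tColourGraph ω true) (tBall x (2 * s) \ tBall x s) c, (R : ℤ) ≤ triNorm (v - w) := by
    by_cases hu2 : (R : ℤ) ≤ triNorm (u - w)
    · exact ⟨u, hu, hu2⟩
    · refine ⟨u', hu', ?_⟩
      have h1 := triNorm_sub_le_triNorm_sub_add u w u'
      have h2 : triNorm (w - u') = triNorm (u' - w) := by rw [← triNorm_neg, neg_sub]
      omega
  obtain ⟨v, hv, hvR⟩ := hfar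
  have hcv : c ≠ v := by rintro rfl; omega
  have hp : PathIn (tColourGraph ω true) (tBall x (2 * s) \ tBall x s) c v := hv
  have hcω : c ∈ ω := by rw [tColourGraph_true] at hp; exact NeckCoarse.mem_of_pathIn_ne hp hcv
  obtain ⟨p, q, hpn, hqn, hc⟩ := (NeckCoarse.pathIn_inter_of_pathIn_open hp hcω).exists_annulus_arm (r := r + 1)
    (R := R) (by push_cast; omega) hvR hrR
  exact ⟨p, q, hpn, hqn, NeckCoarse.pathIn_open_of_pathIn_inter (hc.mono fun z hz ↦ ⟨hz.2, hz.1.2⟩)⟩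

/-! ## §2 Probability: locality, the a priori one-arm bound moved to the centre `w`, independence -/

/-- The one-arm event reads only the sites of its annulus. -/
theorem determinedBy_tOneArm (w : Site 2) (r R : ℕ) :
    DeterminedBy {ω : SiteConfig (Site 2) | ∃ p q : Site 2, triNorm (p - w) = r ∧ triNorm (q - w) = R ∧
        PathIn (tColourGraph ω true) {y | (r : ℤ) ≤ triNorm (y - w) ∧ triNorm (y - w) ≤ R} p q}
      {y | (r : ℤ) ≤ triNorm (y - w) ∧ triNorm (y - w) ≤ R} := by
  rw [determinedBy_iff]
  intro ω ω' h
  have hc : ∀ a b, PathIn (tColourGraph ω true) {y | (r : ℤ) ≤ triNorm (y - w) ∧ triNorm (y - w) ≤ R} a b ↔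
      PathIn (tColourGraph ω' true) {y | (r : ℤ) ≤ triNorm (y - w) ∧ triNorm (y - w) ≤ R} a b :=
    pathIn_congr_of_adj_iff (tColourGraph_adj_iff_of_inter_eq h true)
  simp only [mem_setOf_eq, hc]

/-- The one-arm event is measurable. -/
theorem measurableSet_tOneArm (w : Site 2) (r R : ℕ) :
    MeasurableSet {ω : SiteConfig (Site 2) | ∃ p q : Site 2, triNorm (p - w) = r ∧ triNorm (q - w) = R ∧
      PathIn (tColourGraph ω true) {y | (r : ℤ) ≤ triNorm (y - w) ∧ triNorm (y - w) ≤ R} p q} :=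
  measurableSet_of_determinedBy_finite (finite_tAnnulus w r R) (determinedBy_tOneArm w r R)

/-- **Translation**: the one-arm event around `w` is the preimage of the one around the origin under the relabelling of
the configuration by `y ↦ y - w`. -/
theorem tOneArm_eq_preimage (w : Site 2) (r R : ℕ) :
    {ω : SiteConfig (Site 2) | ∃ p q : Site 2, triNorm (p - w) = r ∧ triNorm (q - w) = R ∧
        PathIn (tColourGraph ω true) {y | (r : ℤ) ≤ triNorm (y - w) ∧ triNorm (y - w) ≤ R} p q} =
      SiteConfig.relabel (triShiftIso (-w)).toEquiv ⁻¹'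
        {ω : SiteConfig (Site 2) | ∃ p q : Site 2, triNorm (p - 0) = r ∧ triNorm (q - 0) = R ∧
          PathIn (tColourGraph ω true) {y | (r : ℤ) ≤ triNorm (y - 0) ∧ triNorm (y - 0) ≤ R} p q} := by
  ext ω
  rw [mem_preimage]
  constructor
  · rintro ⟨p, q, hp, hq, hP⟩
    have k := NeckCoarse.pathIn_open_shift w w hP
    rw [sub_self] at k
    exact ⟨p - w, q - w, by rwa [sub_zero], by rwa [sub_zero], k⟩
  · rintro ⟨p, q, hp, hq, hP⟩
    have k := NeckCoarse.pathIn_open_shift (-w) 0 hP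
    rw [NeckCoarse.relabel_shift_neg_neg, zero_sub, neg_neg, sub_neg_eq_add, sub_neg_eq_add] at k
    rw [sub_zero] at hp hq
    exact ⟨p + w, q + w, by rwa [add_sub_cancel_right], by rwa [add_sub_cancel_right], k⟩

/-- At the origin the one-arm event is a sub-event of the tree's `armEvent ![true] r R` (`r < R`). -/
theorem tOneArm_zero_subset_armEvent {r R : ℕ} (hrR : r < R) :
    {ω : SiteConfig (Site 2) | ∃ p q : Site 2, triNorm (p - 0) = r ∧ triNorm (q - 0) = R ∧
        PathIn (tColourGraph ω true) {y | (r : ℤ) ≤ triNorm (y - 0) ∧ triNorm (y - 0) ≤ R} p q} ⊆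
      armEvent ![true] r R := by
  rintro ω ⟨p, q, hp, hq, hP⟩
  rw [tAnnulus_zero_eq_triAnn] at hP
  rw [sub_zero] at hp hq
  have hne : p ≠ q := by rintro rfl; omega
  have hpω : p ∈ ω := by rw [tColourGraph_true] at hP; exact NeckCoarse.mem_of_pathIn_ne hP hne
  refine (mem_armEvent_one_iff_exists_pathIn hrR.le).2 ⟨p, mem_triSphere_iff.2 hp, q, mem_triSphere_iff.2 hq, ?_⟩
  have e : {v : Site 2 | (r : ℤ) ≤ triNorm v ∧ triNorm v ≤ R} ∩ {v | v ∈ ω ↔ true} = triAnn r R ∩ ω := by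
    ext v; simp
  rw [e]
  exact NeckCoarse.pathIn_inter_of_pathIn_open hP hpω

/-- **`P_{1/2}(one open arm across {r ≤ |· - w| ≤ R}) ≤ C (r/R)^α`** with the constants of the tree's a priori one-arm
bound (`exists_polyArmProb_one_le_rpow`), for all centres `w` and `1 ≤ r < R`. -/
theorem real_tOneArm_le : ∃ C α : ℝ, 0 < C ∧ 0 < α ∧ ∀ (w : Site 2) (r R : ℕ), 1 ≤ r → r < R →
    (triSitePercolation half).real {ω : SiteConfig (Site 2) | ∃ p q : Site 2, triNorm (p - w) = r ∧
      triNorm (q - w) = R ∧ PathIn (tColourGraph ω true) {y | (r : ℤ) ≤ triNorm (y - w) ∧ triNorm (y - w) ≤ R} p q} ≤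
      C * ((r : ℝ) / R) ^ α := by
  obtain ⟨C, α, hC, hα, h⟩ := exists_polyArmProb_one_le_rpow
  refine ⟨C, α, hC, hα, fun w r R hr hrR ↦ ?_⟩
  rw [tOneArm_eq_preimage w r R, triSitePercolation, sitePercolation_real_preimage_relabel]
  exact (measureReal_mono (tOneArm_zero_subset_armEvent hrR) (measure_ne_top _ _)).trans (h true r R hr hrR.le)

/-- **One-arm events across pairwise disjoint hexagonal annuli are jointly independent under `P_{1/2}`.** -/
theorem real_biInter_tOneArm_eq_prod {ι : Type*} (t : Finset ι) (w : ι → Site 2) (r R : ι → ℕ)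
    (hdisj : (↑t : Set ι).PairwiseDisjoint fun i ↦ {y : Site 2 | (r i : ℤ) ≤ triNorm (y - w i) ∧ triNorm (y - w i) ≤ R i}) :
    (triSitePercolation half).real (⋂ i ∈ t, {ω : SiteConfig (Site 2) | ∃ p q : Site 2, triNorm (p - w i) = r i ∧
        triNorm (q - w i) = R i ∧
        PathIn (tColourGraph ω true) {y | (r i : ℤ) ≤ triNorm (y - w i) ∧ triNorm (y - w i) ≤ R i} p q}) =
      ∏ i ∈ t, (triSitePercolation half).real {ω : SiteConfig (Site 2) | ∃ p q : Site 2, triNorm (p - w i) = r i ∧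
        triNorm (q - w i) = R i ∧
        PathIn (tColourGraph ω true) {y | (r i : ℤ) ≤ triNorm (y - w i) ∧ triNorm (y - w i) ≤ R i} p q} := by
  classical
  set E : ι → Set (SiteConfig (Site 2)) := fun i ↦ {ω | ∃ p q : Site 2, triNorm (p - w i) = r i ∧
    triNorm (q - w i) = R i ∧
    PathIn (tColourGraph ω true) {y | (r i : ℤ) ≤ triNorm (y - w i) ∧ triNorm (y - w i) ≤ R i} p q} with hE
  have hdet : ∀ u : Finset ι, DeterminedBy (⋂ i ∈ u, E i)
      (⋃ i ∈ u, {y : Site 2 | (r i : ℤ) ≤ triNorm (y - w i) ∧ triNorm (y - w i) ≤ R i}) := fun u ↦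
    DeterminedBy.iInter fun i ↦ DeterminedBy.iInter fun hi ↦ (determinedBy_tOneArm (w i) (r i) (R i)).mono
      fun y hy ↦ mem_biUnion hi hy
  have hmeas : ∀ u : Finset ι, MeasurableSet (⋂ i ∈ u, E i) := fun u ↦
    Finset.measurableSet_biInter u fun i _ ↦ measurableSet_tOneArm (w i) (r i) (R i)
  change (triSitePercolation half).real (⋂ i ∈ t, E i) = ∏ i ∈ t, (triSitePercolation half).real (E i)
  induction t using Finset.induction_on with
  | empty => simp
  | @insert a t ha ih =>
    have hdisj' : (↑t : Set ι).PairwiseDisjoint fun i ↦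
        {y : Site 2 | (r i : ℤ) ≤ triNorm (y - w i) ∧ triNorm (y - w i) ≤ R i} := hdisj.subset (by simp)
    rw [Finset.prod_insert ha, Finset.set_biInter_insert, ← ih hdisj']
    refine measureReal_inter_of_determinedBy_compl (measurableSet_tOneArm _ _ _) (hmeas t)
      (determinedBy_tOneArm _ _ _) ((hdet t).mono ?_)
    intro y hy hya
    simp only [mem_iUnion, exists_prop] at hy
    obtain ⟨i, hi, hyi⟩ := hy
    have hne : a ≠ i := fun h ↦ ha (h ▸ hi)
    exact Set.disjoint_left.1 (hdisj (Finset.mem_insert_self a t) (Finset.mem_insert_of_mem hi) hne) hya hyi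

end NeckCoarse

/-! ## §3 Dense touching by big blobs decays geometrically -/

/-- **Big collar blobs touch prescribed windows only at a geometric cost (registered helper, anchor of this module on
the crux item).**  With the constants `C, α > 0` of the tree's a priori one-arm bound: for every finite family of
centres `w i` whose annuli `{r+1 ≤ |· - w i|_𝕋 ≤ R}` are pairwise disjoint, `1 ≤ r`, `r + 2 ≤ R`, `2 (R + r) ≤ lam`, the
probability that for EVERY `i` some site within `𝕋`-distance `r` of `w i` lies in a collar blob (of the collar
`Λ_{2s}(x) ∖ Λ_s(x)`) of `𝕋`-diameter `≥ lam` is at most `(C ((r+1)/R)^α)^{#t}`. -/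
theorem real_forall_bigBlobT_near_le_pow : ∃ C α : ℝ, 0 < C ∧ 0 < α ∧ ∀ (ι : Type) (t : Finset ι) (w : ι → Site 2) (x : Site 2) (s lam r R : ℕ), 1 ≤ r → r + 2 ≤ R → 2 * (R + r) ≤ lam → (↑t : Set ι).PairwiseDisjoint (fun i ↦ {y : Site 2 | ((r + 1 : ℕ) : ℤ) ≤ triNorm (y - w i) ∧ triNorm (y - w i) ≤ R}) → (triSitePercolation half).real (⋂ i ∈ t, {ω | ∃ c : Site 2, triNorm (c - w i) ≤ r ∧ ∃ u ∈ blobOf (tColourGraph ω true) (tBall x (2 * s) \ tBall x s) c, ∃ u' ∈ blobOf (tColourGraph ω true) (tBall x (2 * s) \ tBall x s) c, (lam : ℤ) ≤ triNorm (u - u')}) ≤ (C * (((r + 1 : ℕ) : ℝ) / (R : ℝ)) ^ α) ^ t.card := by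
  obtain ⟨C, α, hC, hα, h1⟩ := NeckCoarse.real_tOneArm_le
  refine ⟨C, α, hC, hα, fun ι t w x s lam r R hr hrR hlam hdisj ↦ ?_⟩
  set μ := triSitePercolation half with hμ
  set E : ι → Set (SiteConfig (Site 2)) := fun i ↦ {ω | ∃ p q : Site 2, triNorm (p - w i) = (r + 1 : ℕ) ∧
    triNorm (q - w i) = R ∧
    PathIn (tColourGraph ω true) {y | ((r + 1 : ℕ) : ℤ) ≤ triNorm (y - w i) ∧ triNorm (y - w i) ≤ R} p q} with hE
  -- the touch events imply the one-arm events
  have hcover : (⋂ i ∈ t, {ω | ∃ c : Site 2, triNorm (c - w i) ≤ r ∧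
      ∃ u ∈ blobOf (tColourGraph ω true) (tBall x (2 * s) \ tBall x s) c,
        ∃ u' ∈ blobOf (tColourGraph ω true) (tBall x (2 * s) \ tBall x s) c, (lam : ℤ) ≤ triNorm (u - u')}) ⊆
      ⋂ i ∈ t, E i := by
    intro ω hω
    simp only [mem_iInter] at hω ⊢
    intro i hi
    obtain ⟨c, hcw, hbig⟩ := hω i hi
    exact NeckCoarse.tOneArm_of_bigBlob hcw (by omega) hlam hbig
  calc μ.real _ ≤ μ.real (⋂ i ∈ t, E i) := measureReal_mono hcover (measure_ne_top _ _)
    _ = ∏ i ∈ t, μ.real (E i) := NeckCoarse.real_biInter_tOneArm_eq_prod t w (fun _ ↦ r + 1) (fun _ ↦ R) hdisj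
    _ ≤ ∏ _i ∈ t, C * (((r + 1 : ℕ) : ℝ) / (R : ℝ)) ^ α :=
        Finset.prod_le_prod (fun i _ ↦ measureReal_nonneg) fun i _ ↦ h1 (w i) (r + 1) R (by omega) (by omega)
    _ = (C * (((r + 1 : ℕ) : ℝ) / (R : ℝ)) ^ α) ^ t.card := Finset.prod_const _

namespace NeckCoarse

variable {ω : SiteConfig (Site 2)}

/-! ## §4 Iterated BK for local increasing site events; witnesses in distinct clusters -/

/-- An iterated disjoint occurrence of events determined by `F` is determined by `F`. -/
theorem determinedBy_disjointOccurrenceList {V : Type*} {F : Set V} (l : List (Set (SiteConfig V)))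
    (hup : ∀ A ∈ l, IsUpperSet A) (hdet : ∀ A ∈ l, DeterminedBy A F) : DeterminedBy (disjointOccurrenceList l) F := by
  induction l with
  | nil => exact determinedBy_univ F
  | cons A l ih =>
    rw [disjointOccurrenceList_cons]
    exact DeterminedBy.disjointOccurrence_of_isUpperSet (hup A (by simp))
      (isUpperSet_disjointOccurrenceList fun B hB ↦ hup B (by simp [hB])) (hdet A (by simp))
      (ih (fun B hB ↦ hup B (by simp [hB])) fun B hB ↦ hdet B (by simp [hB]))

/-- **Iterated van den Berg–Kesten inequality for site percolation**: for a list of increasing events determined by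
one finite set of sites, `P_p(A₁ □ (A₂ □ ⋯)) ≤ ∏ P_p(Aᵢ)`. -/
theorem sitePercolation_bk_list {V : Type*} (p : unitInterval) {F : Finset V} (l : List (Set (SiteConfig V)))
    (hup : ∀ A ∈ l, IsUpperSet A) (hdet : ∀ A ∈ l, DeterminedBy A ↑F) :
    (sitePercolation V p).real (disjointOccurrenceList l) ≤ (l.map (sitePercolation V p).real).prod := by
  induction l with
  | nil => simp
  | cons A l ih =>
    have hupl : ∀ B ∈ l, IsUpperSet B := fun B hB ↦ hup B (by simp [hB])
    have hdetl : ∀ B ∈ l, DeterminedBy B ↑F := fun B hB ↦ hdet B (by simp [hB])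
    rw [disjointOccurrenceList_cons, List.map_cons, List.prod_cons]
    calc (sitePercolation V p).real (A □ disjointOccurrenceList l)
        ≤ (sitePercolation V p).real A * (sitePercolation V p).real (disjointOccurrenceList l) :=
          sitePercolation_bk p (hdet A (by simp)) (determinedBy_disjointOccurrenceList l hupl hdetl) (hup A (by simp))
            (isUpperSet_disjointOccurrenceList hupl)
      _ ≤ (sitePercolation V p).real A * (l.map (sitePercolation V p).real).prod :=
          mul_le_mul_of_nonneg_left (ih hupl hdetl) measureReal_nonneg

/-- The one-arm event is increasing. -/
theorem isUpperSet_tOneArm (w : Site 2) (r R : ℕ) :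
    IsUpperSet {ω : SiteConfig (Site 2) | ∃ p q : Site 2, triNorm (p - w) = r ∧ triNorm (q - w) = R ∧
      PathIn (tColourGraph ω true) {y | (r : ℤ) ≤ triNorm (y - w) ∧ triNorm (y - w) ≤ R} p q} := by
  rintro ω ω' hle ⟨p, q, hp, hq, hpath⟩
  refine ⟨p, q, hp, hq, hpath.mono_graph ?_⟩
  rw [tColourGraph_true, tColourGraph_true]
  exact siteOpenGraph_mono triGraph hle

/-- **Witnesses in distinct clusters**: if pairwise distinct open clusters join each `c i` (`|c i - w i|_𝕋 < r i`) to
`𝕋`-distance `≥ R i` from `w i` (`r i < R i`), then the one-arm events around the `w i` occur disjointly — the tight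
support of the open path from `c i`, cut down to the annulus, is an open witness, and witnesses of distinct clusters
are disjoint. -/
theorem mem_disjointOccurrenceList_of_distinctClusters {ι : Type*} (l : List ι) (hl : l.Nodup) (w c : ι → Site 2)
    (r R : ι → ℕ) (hrR : ∀ i ∈ l, r i < R i) (hnear : ∀ i ∈ l, triNorm (c i - w i) < r i)
    (hfar : ∀ i ∈ l, ∃ q, (R i : ℤ) ≤ triNorm (q - w i) ∧ PathIn (tColourGraph ω true) univ (c i) q)
    (hdist : ∀ i ∈ l, ∀ j ∈ l, i ≠ j → ¬ PathIn (tColourGraph ω true) univ (c i) (c j)) :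
    ω ∈ disjointOccurrenceList (l.map fun i ↦ {ω : SiteConfig (Site 2) | ∃ p q : Site 2, triNorm (p - w i) = r i ∧
      triNorm (q - w i) = R i ∧
      PathIn (tColourGraph ω true) {y | (r i : ℤ) ≤ triNorm (y - w i) ∧ triNorm (y - w i) ≤ R i} p q}) := by
  classical
  -- tight supports and crossing extraction, cluster by cluster
  have key : ∀ i ∈ l, ∃ K : Set (Site 2), K ⊆ ω ∧
      K ∈ {ω : SiteConfig (Site 2) | ∃ p q : Site 2, triNorm (p - w i) = r i ∧ triNorm (q - w i) = R i ∧
        PathIn (tColourGraph ω true) {y | (r i : ℤ) ≤ triNorm (y - w i) ∧ triNorm (y - w i) ≤ R i} p q} ∧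
      ∀ z ∈ K, PathIn (tColourGraph ω true) univ (c i) z := by
    intro i hi
    obtain ⟨q, hqR, hpath⟩ := hfar i hi
    have hne : c i ≠ q := by
      rintro h
      have := hnear i hi; have := hrR i hi; rw [← h] at hqR; omega
    have hcω : c i ∈ ω := by rw [tColourGraph_true] at hpath; exact NeckCoarse.mem_of_pathIn_ne hpath hne
    obtain ⟨S, hS, hP, hSt⟩ := (NeckCoarse.pathIn_inter_of_pathIn_open hpath hcω).exists_support
    obtain ⟨p₁, q₁, hp₁, hq₁, hcross⟩ := hP.exists_annulus_arm (hnear i hi).le hqR (hrR i hi)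
    refine ⟨S, fun z hz ↦ (hS hz).2, ⟨p₁, q₁, hp₁, hq₁, ?_⟩, fun z hz ↦ ?_⟩
    · exact NeckCoarse.pathIn_open_of_pathIn_inter (hcross.mono fun z hz ↦ ⟨hz.2, hz.1⟩)
    · exact NeckCoarse.pathIn_open_of_pathIn_inter ((hSt z hz).mono fun y hy ↦ ⟨mem_univ y, (hS hy).2⟩)
  choose! K hKω hKA hKc using key
  have hmem := mem_disjointOccurrenceList_of_pairwise_disjoint
    (l.map fun i ↦ ({ω : SiteConfig (Site 2) | ∃ p q : Site 2, triNorm (p - w i) = r i ∧ triNorm (q - w i) = R i ∧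
      PathIn (tColourGraph ω true) {y | (r i : ℤ) ≤ triNorm (y - w i) ∧ triNorm (y - w i) ≤ R i} p q}, K i))
    (fun p hp ↦ by
      obtain ⟨i, -, rfl⟩ := List.mem_map.1 hp
      exact isUpperSet_tOneArm _ _ _)
    (fun p hp ↦ by
      obtain ⟨i, hi, rfl⟩ := List.mem_map.1 hp
      exact hKA i hi)
    ?_ (ω := ω) (fun p hp ↦ by
      obtain ⟨i, hi, rfl⟩ := List.mem_map.1 hp
      exact hKω i hi)
  · simpa only [List.map_map, Function.comp_def] using hmem
  · rw [List.pairwise_map]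
    refine hl.pairwise_of_forall_ne fun i hi j hj hij ↦ ?_
    rw [Set.disjoint_left]
    intro z hzi hzj
    exact hdist i hi j hj hij ((hKc i hi z hzi).trans (hKc j hj z hzj).symm)

end NeckCoarse

/-! ## §5 The BK bound for arms of distinct clusters -/

/-- **Arms of pairwise distinct open clusters cost the product of the one-arm bounds (registered helper, anchor of this
module on the crux item).**  There are `C, α > 0` (the constants of `NeckCoarse.real_tOneArm_le`) such that for every
finite index set `t`, centres `w i`, radii `1 ≤ r i < R i` — the annuli may OVERLAP arbitrarily — the probability under
`P_{1/2}` on `𝕋` that there are sites `c i` with `|c i - w i|_𝕋 < r i`, each joined by an open path to `𝕋`-distance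
`≥ R i` from `w i`, the `c i` lying in pairwise DISTINCT open clusters, is at most `∏ C (r i / R i)^α` (crossing
extraction, site-disjoint tight supports, iterated BK, `real_tOneArm_le`). -/
theorem real_distinctClustersT_arms_le_prod : ∃ C α : ℝ, 0 < C ∧ 0 < α ∧ ∀ (ι : Type) (t : Finset ι) (w : ι → Site 2) (r R : ι → ℕ), (∀ i ∈ t, 1 ≤ r i ∧ r i < R i) → (triSitePercolation half).real {ω | ∃ c : ι → Site 2, (∀ i ∈ t, triNorm (c i - w i) < r i ∧ ∃ q, (R i : ℤ) ≤ triNorm (q - w i) ∧ PathIn (tColourGraph ω true) Set.univ (c i) q) ∧ ∀ i ∈ t, ∀ j ∈ t, i ≠ j → ¬ PathIn (tColourGraph ω true) Set.univ (c i) (c j)} ≤ ∏ i ∈ t, C * ((r i : ℝ) / (R i : ℝ)) ^ α := by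
  obtain ⟨C, α, hC, hα, h1⟩ := NeckCoarse.real_tOneArm_le
  refine ⟨C, α, hC, hα, fun ι t w r R hrR ↦ ?_⟩
  classical
  set μ := triSitePercolation half with hμ
  set A : ι → Set (SiteConfig (Site 2)) := fun i ↦ {ω | ∃ p q : Site 2, triNorm (p - w i) = r i ∧
    triNorm (q - w i) = R i ∧
    PathIn (tColourGraph ω true) {y | (r i : ℤ) ≤ triNorm (y - w i) ∧ triNorm (y - w i) ≤ R i} p q} with hA
  set L := t.toList.map A with hL
  have hcover : {ω : SiteConfig (Site 2) | ∃ c : ι → Site 2, (∀ i ∈ t, triNorm (c i - w i) < r i ∧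
      ∃ q, (R i : ℤ) ≤ triNorm (q - w i) ∧ PathIn (tColourGraph ω true) Set.univ (c i) q) ∧
      ∀ i ∈ t, ∀ j ∈ t, i ≠ j → ¬ PathIn (tColourGraph ω true) Set.univ (c i) (c j)} ⊆ disjointOccurrenceList L := by
    rintro ω ⟨c, hc, hdist⟩
    exact NeckCoarse.mem_disjointOccurrenceList_of_distinctClusters t.toList (Finset.nodup_toList t) w c r R
      (fun i hi ↦ (hrR i (Finset.mem_toList.1 hi)).2)
      (fun i hi ↦ (hc i (Finset.mem_toList.1 hi)).1) (fun i hi ↦ (hc i (Finset.mem_toList.1 hi)).2)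
      fun i hi j hj hij ↦ hdist i (Finset.mem_toList.1 hi) j (Finset.mem_toList.1 hj) hij
  have hup : ∀ B ∈ L, IsUpperSet B := fun B hB ↦ by
    obtain ⟨i, -, rfl⟩ := List.mem_map.1 hB
    exact NeckCoarse.isUpperSet_tOneArm _ _ _
  -- all the one-arm events read the finite union of their annuli
  set F : Finset (Site 2) := t.biUnion fun i ↦ (finite_tAnnulus (w i) (r i) (R i)).toFinset with hF
  have hdet : ∀ B ∈ L, DeterminedBy B ↑F := fun B hB ↦ by
    obtain ⟨i, hi, rfl⟩ := List.mem_map.1 hB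
    refine (NeckCoarse.determinedBy_tOneArm (w i) (r i) (R i)).mono fun y hy ↦ ?_
    rw [hF, Finset.coe_biUnion]
    exact mem_biUnion (Finset.mem_coe.2 (Finset.mem_toList.1 hi)) (by simpa using hy)
  calc μ.real _ ≤ μ.real (disjointOccurrenceList L) := measureReal_mono hcover (measure_ne_top _ _)
    _ ≤ (L.map μ.real).prod := NeckCoarse.sitePercolation_bk_list half L hup hdet
    _ = ∏ i ∈ t, μ.real (A i) := by rw [hL, List.map_map, Function.comp_def, Finset.prod_map_toList]
    _ ≤ ∏ i ∈ t, C * ((r i : ℝ) / (R i : ℝ)) ^ α :=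
        Finset.prod_le_prod (fun i _ ↦ measureReal_nonneg) fun i hi ↦ h1 (w i) (r i) (R i) (hrR i hi).1 (hrR i hi).2

end Summit.CriticalPhenomena.CardyFormulaZ2.Cruxes.NestingRigidity.PinchResampling

end
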